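import Summits.AtomisticToContinuum.FouriersLaw.Theorems.OddSectorIrreversibilityTapLeakBoundResamplePreserving
import Summits.AtomisticToContinuum.FouriersLaw.Theorems.OddSectorIrreversibilityTapLeakBoundCorrectorSmooth
import Summits.AtomisticToContinuum.FouriersLaw.Theorems.OddSectorIrreversibilityTapLeakBoundGaussIBP
import Summits.AtomisticToContinuum.FouriersLaw.Theorems.OddSectorIrreversibilityCorrectorTheory
import Summits.AtomisticToContinuum.FouriersLaw.Theorems.OddSectorIrreversibilityWitnessGlueTangent

/-!
# `TapLeakBound` (stmt-AtomisticToContinuum-15159), line `Sketch`: resampling calculus, pairing bound, split glue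

Helper file (`--supports stmt-AtomisticToContinuum-15159`; proves the registered stub `stub_pairingBound`) for crux
P = `OddSectorIrreversibility.TapLeakBound` (route `OddSectorIrreversibility`, sub-problem `FouriersLaw`). With
`μ_T = gibbsWeight` (unnormalised), `ν = μ_T ⊗ N(0,T)`, `σ(x,p') = (q, p[b ↦ p'])`, `𝒩_b = -T∂²_{p_b} + p_b∂_{p_b}`,
`g = j_i ∘ Φ_s` (closed flow), `u⁺ = (u + u∘Θ)/2`:
* `memLp_gibbsMeasure_of_gibbsWeight` / `…_of_gibbsMeasure`, `memLp_resample` (`g ∘ σ ∈ L²(ν)`, from the landed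
  `stub_resamplePreserving`), `integral_gaussian_ou_eq_zero` (1-D Gaussian IBP), `integral_tapOp_mul_resample_eq_zero`
  (RESAMPLING ORTHOGONALITY `∫ (𝒩_b f)(x) g(σ(x,p')) dν = 0`);
* `abs_pairing_le_sqrt_mul_sqrt` = `stub_pairingBound`:
  `|T ∫ ∂_b u⁺ ∂_b g dμ_T| ≤ √(∫ (𝒩_b u⁺)² dμ_T) · √(∫∫ (g(σ(x,p')) - g(x))² dN(0,T) dμ_T)` (Gaussian IBP `stub_gaussIBP`,
  orthogonality, Cauchy–Schwarz on `L²(ν)`);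
* `tapLeakBound_of_hermite_of_kickCone` — the route header's foreseen glued split **H1 → C′ → TapLeakBound**, PROVED
  (H1 = `BoundaryHermiteRegularity`, C′ = `ResampledKickCone`, the registered `N`-uniform stubs `stub_hermite`,
  `stub_kickCone` verbatim as hypotheses; conditional — the item is NOT closed here). References: folklore.
-/

noncomputable section

open MeasureTheory ProbabilityTheory Filter Topology Set Function
open scoped NNReal ENNReal ContDiff

namespace Summit.AtomisticToContinuum.FouriersLaw.Theorems.OddSectorIrreversibility.TapLeak

open Literature.MathematicalPhysics.KineticTheory.HeatConduction
open Literature.MathematicalPhysics.KineticTheory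
open Summit.AtomisticToContinuum.FouriersLaw.Theses.OddSectorIrreversibility (TapLeakBound)
open Summit.AtomisticToContinuum.FouriersLaw.Theorems.ClosedConeSensitivity.Negative.ZeroFrictionDictionary
open Summit.AtomisticToContinuum.FouriersLaw.Theorems.OddSectorWitness
open Summit.AtomisticToContinuum.FouriersLaw.Theorems.OddSectorIrreversibility.Corrector

/-! ### Bookkeeping between the Gibbs weight `μ_T` and the Gibbs measure `π_T = μ_T / Z` -/

section Weight

variable {ω₂ lam β : ℝ} (hω : 0 < ω₂) (hl : 0 ≤ lam) (hβ : 0 ≤ β) (γ : ℝ) (N : ℕ) {T : ℝ} (hT : 0 < T)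
include hω hl hβ hT

/-- `L^p(μ_T) ⊆ L^p(π_T)`. [folklore] -/
theorem memLp_gibbsMeasure_of_gibbsWeight {f : PhaseSpace N → ℝ} {p : ℝ≥0∞}
    (hf : MemLp f p (gibbsWeight ω₂ lam β γ N T)) :
    MemLp f p ((pinnedChain ω₂ lam β γ).gibbsMeasure N T) := by
  have hZ0 := (pinnedChain ω₂ lam β γ).partitionFunction_ne_zero (N := N) (T := T)
    (pinnedChain_continuous_gibbsDensity ω₂ lam β γ N T)
  have hZt := (pinnedChain ω₂ lam β γ).partitionFunction_ne_top
    (pinnedChain_integrable_gibbsDensity hω hl hβ γ N hT)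
  have h := hf.smul_measure (ENNReal.inv_ne_top.2 hZ0)
  rw [gibbsWeight_eq_smul_gibbsMeasure hω hl hβ hT, smul_smul, ENNReal.inv_mul_cancel hZ0 hZt,
    one_smul] at h
  exact h

/-- `L^p(π_T) ⊆ L^p(μ_T)`. [folklore] -/
theorem memLp_gibbsWeight_of_gibbsMeasure {f : PhaseSpace N → ℝ} {p : ℝ≥0∞}
    (hf : MemLp f p ((pinnedChain ω₂ lam β γ).gibbsMeasure N T)) :
    MemLp f p (gibbsWeight ω₂ lam β γ N T) := by
  have hZt := (pinnedChain ω₂ lam β γ).partitionFunction_ne_top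
    (pinnedChain_integrable_gibbsDensity hω hl hβ γ N hT)
  rw [gibbsWeight_eq_smul_gibbsMeasure hω hl hβ hT]
  exact hf.smul_measure hZt

end Weight

/-- For `g ∈ L²(μ_T)`, `(x, p') ↦ g(q, p[b ↦ p'])` is in `L²(μ_T ⊗ N(0,T))` (`(g ∘ fst) ∘ S` with the
measure-preserving resampling involution `S` of `stub_resamplePreserving`). [folklore] -/
theorem memLp_resample (ω₂ lam β γ : ℝ) {T : ℝ} (hT : 0 < T) {N : ℕ} (b : Fin N) {g : PhaseSpace N → ℝ}
    (hg : MemLp g 2 (gibbsWeight ω₂ lam β γ N T)) :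
    MemLp (fun z : PhaseSpace N × ℝ => g (z.1.1, Function.update z.1.2 b z.2)) 2
      ((gibbsWeight ω₂ lam β γ N T).prod (gaussianReal 0 (Real.toNNReal T))) := by
  have h1 : MemLp (fun z : PhaseSpace N × ℝ => g z.1) 2
      ((gibbsWeight ω₂ lam β γ N T).prod (gaussianReal 0 (Real.toNNReal T))) :=
    hg.comp_fst (gaussianReal 0 (Real.toNNReal T))
  exact h1.comp_measurePreserving (stub_resamplePreserving ω₂ lam β γ hT b)

section Orthogonal

/-- **One-dimensional Gaussian integration by parts**: `∫ φ_T(t) (-T h''(t) + t h'(t)) dt = 0` when `φ_T h'` and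
`φ_T (-T h'' + t h')` are integrable (`φ_T` the `N(0,T)` density; the integrand is `-T (φ_T h')'`). [folklore] -/
theorem integral_gaussian_ou_eq_zero {T : ℝ} (hT : 0 < T) {h' h'' : ℝ → ℝ}
    (hd : ∀ t, HasDerivAt h' (h'' t) t)
    (hI1 : Integrable (fun t => gaussianPDFReal 0 T.toNNReal t * h' t))
    (hI2 : Integrable (fun t => gaussianPDFReal 0 T.toNNReal t * (-(T * h'' t) + t * h' t))) :
    ∫ t, gaussianPDFReal 0 T.toNNReal t * (-(T * h'' t) + t * h' t) = 0 := by
  set v : ℝ≥0 := T.toNNReal with hv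
  have hvT : ((v : ℝ≥0) : ℝ) = T := Real.coe_toNNReal T hT.le
  have hT0 : T ≠ 0 := hT.ne'
  set φ : ℝ → ℝ := gaussianPDFReal 0 v with hφ
  set c : ℝ := (Real.sqrt (2 * Real.pi * T))⁻¹ with hc
  have e : φ = fun s => c * Real.exp (-s ^ 2 / (2 * T)) := by
    funext s
    simp only [hφ, gaussianPDFReal, sub_zero, hvT, hc]
  have hφd : ∀ t, HasDerivAt φ (φ t * (-t / T)) t := by
    intro t
    have h3 : HasDerivAt (fun s => c * Real.exp (-s ^ 2 / (2 * T)))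
        (c * (Real.exp (-t ^ 2 / (2 * T)) * (-(((2 : ℕ) : ℝ) * t ^ (2 - 1)) / (2 * T)))) t :=
      (((hasDerivAt_pow 2 t).neg.div_const (2 * T)).exp).const_mul c
    rw [e]; refine h3.congr_deriv ?_; norm_num; field_simp
  have hψd : ∀ t, HasDerivAt (fun s => φ s * h' s) (-(1 / T) * (φ t * (-(T * h'' t) + t * h' t))) t := by
    intro t; refine ((hφd t).mul (hd t)).congr_deriv ?_; field_simp; ring
  have hψ'I : Integrable (fun t => -(1 / T) * (φ t * (-(T * h'' t) + t * h' t))) := hI2.const_mul _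
  have h0 := integral_eq_zero_of_hasDerivAt_of_integrable hψd hψ'I hI1
  rw [integral_const_mul] at h0
  have hT1 : -(1 / T) ≠ 0 := neg_ne_zero.mpr (one_div_pos.mpr hT).ne'
  exact (mul_eq_zero.1 h0).resolve_left hT1

variable {ω₂ lam β : ℝ} (hω : 0 < ω₂) (hl : 0 ≤ lam) (hβ : 0 ≤ β) (γ : ℝ) {T : ℝ} (hT : 0 < T)
include hω hl hβ hT

/-- **Resampling orthogonality.** For `f ∈ C²` with `∂_{p_b} f, 𝒩_b f ∈ L²(μ_T)` and `g ∈ L²(μ_T)`: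
`∫ (𝒩_b f)(x) g(q, p[b ↦ p']) d(μ_T ⊗ N(0,T)) = 0` (transport by `S`, Fubini, and `integral_gaussian_ou_eq_zero`
on a.e. fibre). [folklore] -/
theorem integral_tapOp_mul_resample_eq_zero {N : ℕ} (b : Fin N) {f g : PhaseSpace N → ℝ}
    (hf : ContDiff ℝ 2 f)
    (hdf : MemLp (partialP b f) 2 (gibbsWeight ω₂ lam β γ N T))
    (hNf : MemLp (fun x => -(T * partialP b (partialP b f) x) + x.2 b * partialP b f x) 2 (gibbsWeight ω₂ lam β γ N T))
    (hg2 : MemLp g 2 (gibbsWeight ω₂ lam β γ N T)) :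
    ∫ z, (-(T * partialP b (partialP b f) z.1) + z.1.2 b * partialP b f z.1) *
        g (z.1.1, Function.update z.1.2 b z.2)
      ∂((gibbsWeight ω₂ lam β γ N T).prod (gaussianReal 0 (Real.toNNReal T))) = 0 := by
  set μ := gibbsWeight ω₂ lam β γ N T with hμ
  set γT : Measure ℝ := gaussianReal 0 (Real.toNNReal T) with hγT
  haveI : IsFiniteMeasure μ := isFiniteMeasure_gibbsWeight hω hl hβ γ N hT
  haveI : SFinite μ := by rw [hμ]; unfold gibbsWeight; infer_instance
  haveI : IsProbabilityMeasure γT := by rw [hγT]; infer_instance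
  have hv : T.toNNReal ≠ 0 := (Real.toNNReal_pos.2 hT).ne'
  set F : PhaseSpace N → ℝ := fun x => -(T * partialP b (partialP b f) x) + x.2 b * partialP b f x with hF
  set σ : PhaseSpace N × ℝ → PhaseSpace N := fun z => (z.1.1, Function.update z.1.2 b z.2) with hσ
  set S : PhaseSpace N × ℝ → PhaseSpace N × ℝ := fun z => (σ z, z.1.2 b) with hS
  have hSp : MeasurePreserving S (μ.prod γT) (μ.prod γT) := stub_resamplePreserving ω₂ lam β γ hT b
  have hSS : ∀ z, S (S z) = z := by rintro ⟨⟨q, p⟩, t⟩; simp [hS, hσ]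
  have hSc : Continuous S := by simp only [hS, hσ]; fun_prop
  have hSm : Measurable S := hSc.measurable
  let e : PhaseSpace N × ℝ ≃ᵐ PhaseSpace N × ℝ :=
    { toFun := S, invFun := S, left_inv := hSS, right_inv := hSS,
      measurable_toFun := hSm, measurable_invFun := hSm }
  have hSe : MeasurableEmbedding S := e.measurableEmbedding
  have hdf1 : ContDiff ℝ 1 (partialP b f) := contDiff_partialP hf (by norm_num) b
  have hFσ : MemLp (fun w => F (σ w)) 2 (μ.prod γT) := by
    have h := (hNf.comp_fst γT).comp_measurePreserving hSp; exact h
  have hdfσ : MemLp (fun w => partialP b f (σ w)) 2 (μ.prod γT) := by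
    have h := (hdf.comp_fst γT).comp_measurePreserving hSp; exact h
  have hg1 : MemLp (fun w : PhaseSpace N × ℝ => g w.1) 2 (μ.prod γT) := hg2.comp_fst γT
  have hI : Integrable (fun w => F (σ w) * g w.1) (μ.prod γT) := hFσ.integrable_mul hg1
  have h1 : ∫ z, F z.1 * g (σ z) ∂(μ.prod γT) = ∫ w, F (σ w) * g w.1 ∂(μ.prod γT) := by
    have h := hSp.integral_comp hSe (fun w => F (σ w) * g w.1)
    rw [← h]
    refine integral_congr_ae (Eventually.of_forall fun z => ?_)
    have e1 : σ (S z) = z.1 := by rcases z with ⟨⟨q, p⟩, t⟩; simp [hS, hσ]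
    simp only [e1]; rfl
  have h2 : ∫ w, F (σ w) * g w.1 ∂(μ.prod γT) = ∫ x, (∫ t, F (σ (x, t)) ∂γT) * g x ∂μ := by
    rw [integral_prod _ hI]
    exact integral_congr_ae (Eventually.of_forall fun x => integral_mul_const (g x) _)
  have hae1 : ∀ᵐ x ∂μ, Integrable (fun t => partialP b f (σ (x, t))) γT :=
    (hdfσ.integrable one_le_two).prod_right_ae
  have hae2 : ∀ᵐ x ∂μ, Integrable (fun t => F (σ (x, t))) γT :=
    (hFσ.integrable one_le_two).prod_right_ae
  have h3 : ∀ᵐ x ∂μ, ∫ t, F (σ (x, t)) ∂γT = 0 := by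
    filter_upwards [hae1, hae2] with x hx1 hx2
    set h' : ℝ → ℝ := fun t => partialP b f (σ (x, t)) with hh'
    set h'' : ℝ → ℝ := fun t => partialP b (partialP b f) (σ (x, t)) with hh''
    have hA : Differentiable ℝ fun t : ℝ => σ (x, t) := fun t => by
      have h := ((hasDerivAt_const t x.1).prodMk (hasDerivAt_update x.2 b t)).differentiableAt; exact h
    have hh'd : Differentiable ℝ h' := (hdf1.differentiable one_ne_zero).comp hA
    have hderiv : ∀ t, HasDerivAt h' (h'' t) t := by
      intro t
      have e1 : deriv h' t = h'' t := by
        simp only [hh', hh'', hσ, partialP, Function.update_idem, Function.update_self]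
      exact e1 ▸ (hh'd t).hasDerivAt
    have hFσ_eq : ∀ t, F (σ (x, t)) = -(T * h'' t) + t * h' t := fun t => by
      simp only [hF, hh', hh'', hσ, Function.update_self]
    have hI1 : Integrable (fun t => gaussianPDFReal 0 T.toNNReal t * h' t) := by
      rw [hγT, gaussianReal_of_var_ne_zero 0 hv, integrable_withDensity_iff_integrable_smul'
        (measurable_gaussianPDF 0 _) (Eventually.of_forall fun _ => gaussianPDF_lt_top)] at hx1
      simpa only [toReal_gaussianPDF, smul_eq_mul] using hx1
    have hI2 : Integrable (fun t => gaussianPDFReal 0 T.toNNReal t * (-(T * h'' t) + t * h' t)) := by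
      rw [hγT, gaussianReal_of_var_ne_zero 0 hv, integrable_withDensity_iff_integrable_smul'
        (measurable_gaussianPDF 0 _) (Eventually.of_forall fun _ => gaussianPDF_lt_top)] at hx2
      simpa only [toReal_gaussianPDF, smul_eq_mul, hFσ_eq] using hx2
    have h0 := integral_gaussian_ou_eq_zero hT hderiv hI1 hI2
    rw [hγT, integral_gaussianReal_eq_integral_smul hv]
    simpa only [smul_eq_mul, hFσ_eq] using h0
  rw [h1, h2]
  have h4 : (fun x => (∫ t, F (σ (x, t)) ∂γT) * g x) =ᵐ[μ] fun _ => 0 := by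
    filter_upwards [h3] with x hx; rw [hx, zero_mul]
  rw [integral_congr_ae h4, integral_zero]

end Orthogonal

section Core

variable {ω₂ lam β γ : ℝ} (hω : 0 < ω₂) (hl : 0 < lam) (hβ : 0 < β) (hγ : 0 < γ) {T : ℝ} (hT : 0 < T)
include hω hl hβ hγ hT

/-- **The tap-leak pairing at one `(N, i, b, u, s)`**: `|T ∫ ∂_b u⁺ ∂_b g dμ_T| ≤ √(∫ (𝒩_b u⁺)² dμ_T) · √V`,
`V` the resampled-kick second moment of `g = j_i ∘ Φ_s`. [folklore] -/
theorem abs_pairing_le_sqrt_mul_sqrt {N : ℕ} (i b : Fin N) (hb : b.val = 0 ∨ b.val = N - 1)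
    {u : PhaseSpace N → ℝ} (hu : ContDiff ℝ ∞ u)
    (hu2 : MemLp u 2 (gibbsWeight ω₂ lam β γ N T))
    (hpde : ∀ x, (pinnedChain ω₂ lam β γ).generator N T T u x =
      -(∑ k : Fin N, (pinnedChain ω₂ lam β γ).bondCurrent N k x))
    (hN2 : MemLp (fun x => -(T * partialP b (partialP b (fun y : PhaseSpace N => (u y + u (y.1, -y.2)) / 2)) x) +
      x.2 b * partialP b (fun y : PhaseSpace N => (u y + u (y.1, -y.2)) / 2) x) 2 (gibbsWeight ω₂ lam β γ N T))
    {s : ℝ} (hs : 0 ≤ s) :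
    |T * ∫ x, partialP b (fun y : PhaseSpace N => (u y + u (y.1, -y.2)) / 2) x *
        partialP b (fun y : PhaseSpace N => (pinnedChain ω₂ lam β γ).bondCurrent N i (detFlow ω₂ lam β N s y)) x
        ∂(gibbsWeight ω₂ lam β γ N T)| ≤
      Real.sqrt (∫ x, (-(T * partialP b (partialP b (fun y : PhaseSpace N => (u y + u (y.1, -y.2)) / 2)) x) +
          x.2 b * partialP b (fun y : PhaseSpace N => (u y + u (y.1, -y.2)) / 2) x) ^ 2 ∂(gibbsWeight ω₂ lam β γ N T)) *
      Real.sqrt (∫ x, (∫ p', ((pinnedChain ω₂ lam β γ).bondCurrent N i (detFlow ω₂ lam β N s (x.1, Function.update x.2 b p')) -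
          (pinnedChain ω₂ lam β γ).bondCurrent N i (detFlow ω₂ lam β N s x)) ^ 2 ∂(gaussianReal 0 (Real.toNNReal T)))
          ∂(gibbsWeight ω₂ lam β γ N T)) := by
  set P := pinnedChain ω₂ lam β γ with hP
  set μ := gibbsWeight ω₂ lam β γ N T with hμ
  set γT : Measure ℝ := gaussianReal 0 (Real.toNNReal T) with hγT
  set ue : PhaseSpace N → ℝ := fun y => (u y + u (y.1, -y.2)) / 2 with hue
  set Nue : PhaseSpace N → ℝ := fun x => -(T * partialP b (partialP b ue) x) + x.2 b * partialP b ue x with hNue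
  set g : PhaseSpace N → ℝ := fun y => P.bondCurrent N i (detFlow ω₂ lam β N s y) with hg
  haveI : IsFiniteMeasure μ := isFiniteMeasure_gibbsWeight hω hl.le hβ.le γ N hT
  haveI : SFinite μ := by rw [hμ]; unfold gibbsWeight; infer_instance
  haveI : IsProbabilityMeasure γT := by rw [hγT]; infer_instance
  have hues : ContDiff ℝ ∞ ue := contDiff_evenPart hu
  have hue2 : ContDiff ℝ 2 ue := hues.of_le (by norm_cast)
  have hgs : ContDiff ℝ ∞ g := contDiff_currentFlow hω hl hβ.le γ N i hs
  have hg2s : ContDiff ℝ 2 g := hgs.of_le (by norm_cast)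
  have hgc : Continuous g := hgs.continuous
  have hbw : 0 < OscillatorChain.bathWeight N b := by
    unfold OscillatorChain.bathWeight
    rcases hb with hb | hb
    · rw [if_pos hb]; split_ifs <;> norm_num
    · rw [if_pos hb]; split_ifs <;> norm_num
  have hJc : Continuous fun x : PhaseSpace N => ∑ k : Fin N, P.bondCurrent N k x :=
    continuous_totalBondCurrent ω₂ lam β γ N
  have hϑ : 0 < 1 / (4 * T) := by positivity
  have h2ϑ : 2 * (1 / (4 * T)) < 1 / T := by
    rw [show 2 * (1 / (4 * T)) = 1 / (2 * T) by field_simp; ring, div_lt_div_iff₀ (by positivity) hT]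
    nlinarith
  obtain ⟨M, -, hJM⟩ := abs_totalBondCurrent_le_exp hω.le hl.le hβ.le γ N hϑ
  have hJ2 : MemLp (fun x : PhaseSpace N => ∑ k : Fin N, P.bondCurrent N k x) 2 (P.gibbsMeasure N T) :=
    memLp_two_of_abs_le_exp hω hl.le hβ.le hT γ hJc h2ϑ hJM
  have hu2' : MemLp u 2 (P.gibbsMeasure N T) := memLp_gibbsMeasure_of_gibbsWeight hω hl.le hβ.le γ N hT hu2
  have hdue' : MemLp (partialP b ue) 2 (P.gibbsMeasure N T) :=
    memLp_partialP_evenPart hω hl.le hβ.le hγ hT hu hu2' hJ2 hpde hbw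
  have hdue : MemLp (partialP b ue) 2 μ := memLp_gibbsWeight_of_gibbsMeasure hω hl.le hβ.le γ N hT hdue'
  have hgm2 : MemLp g 2 μ :=
    memLp_gibbsWeight_of_gibbsMeasure hω hl.le hβ.le γ N hT (memLp_currentFlow hω hl hβ.le hT γ N i hs)
  have hdg2 : MemLp (partialP b g) 2 μ :=
    memLp_gibbsWeight_of_gibbsMeasure hω hl.le hβ.le γ N hT (memLp_partialP_currentFlow hω hl hβ.le γ N i b hs hT)
  have hibp : T * ∫ x, partialP b ue x * partialP b g x ∂μ = ∫ x, Nue x * g x ∂μ :=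
    stub_gaussIBP hω hl.le hβ.le γ hT b hue2 hg2s hdue hN2 hgm2 hdg2
  set ν : Measure (PhaseSpace N × ℝ) := μ.prod γT with hν
  set A : PhaseSpace N × ℝ → ℝ := fun z => Nue z.1 with hA
  set G₁ : PhaseSpace N × ℝ → ℝ := fun z => g z.1 with hG₁
  set G₂ : PhaseSpace N × ℝ → ℝ := fun z => g (z.1.1, Function.update z.1.2 b z.2) with hG₂
  have hA2 : MemLp A 2 ν := hN2.comp_fst γT
  have hG12 : MemLp G₁ 2 ν := hgm2.comp_fst γT
  have hG22 : MemLp G₂ 2 ν := memLp_resample ω₂ lam β γ hT b hgm2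
  have horth : ∫ z, A z * G₂ z ∂ν = 0 :=
    integral_tapOp_mul_resample_eq_zero hω hl.le hβ.le γ hT b hue2 hdue hN2 hgm2
  have hfst : ∀ F : PhaseSpace N → ℝ, ∫ z, F z.1 ∂ν = ∫ x, F x ∂μ := fun F => by
    rw [hν, integral_fun_fst, probReal_univ, one_smul]
  have hAG1 : ∫ z, A z * G₁ z ∂ν = ∫ x, Nue x * g x ∂μ := hfst (fun x => Nue x * g x)
  have hI1 : Integrable (fun z => A z * G₁ z) ν := hA2.integrable_mul hG12
  have hI2 : Integrable (fun z => A z * G₂ z) ν := hA2.integrable_mul hG22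
  have hkey : T * ∫ x, partialP b ue x * partialP b g x ∂μ = ∫ z, A z * (G₁ z - G₂ z) ∂ν := by
    rw [hibp, ← hAG1, ← sub_zero (∫ z, A z * G₁ z ∂ν), ← horth, ← integral_sub hI1 hI2]
    refine integral_congr_ae (Eventually.of_forall fun z => ?_)
    ring
  have hCS := abs_integral_mul_le_sqrt hA2 (hG12.sub hG22)
  have hAsq : ∫ z, (A z) ^ 2 ∂ν = ∫ x, (Nue x) ^ 2 ∂μ := hfst (fun x => (Nue x) ^ 2)
  have hVsq : ∫ z, ((G₁ - G₂) z) ^ 2 ∂ν =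
      ∫ x, (∫ p', (g (x.1, Function.update x.2 b p') - g x) ^ 2 ∂γT) ∂μ := by
    have hint : Integrable (fun z => ((G₁ - G₂) z) ^ 2) ν := (hG12.sub hG22).integrable_sq
    rw [hν, integral_prod _ hint]
    refine integral_congr_ae (Eventually.of_forall fun x => integral_congr_ae (Eventually.of_forall fun p' => ?_))
    simp only [hG₁, hG₂, Pi.sub_apply]
    ring
  rw [hkey]
  calc |∫ z, A z * (G₁ z - G₂ z) ∂ν| = |∫ z, A z * (G₁ - G₂) z ∂ν| := by rfl
    _ ≤ Real.sqrt (∫ z, (A z) ^ 2 ∂ν) * Real.sqrt (∫ z, ((G₁ - G₂) z) ^ 2 ∂ν) := hCS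
    _ = _ := by rw [hAsq, hVsq]

end Core

/-- **Registered stub `stub_pairingBound` of line `Sketch`** (= `abs_pairing_le_sqrt_mul_sqrt` with its parameters
explicit): the pairing bound at one `(N, i, b, u, s)`. [folklore] -/
theorem stub_pairingBound : ∀ {ω₂ lam β γ : ℝ}, 0 < ω₂ → 0 < lam → 0 < β → 0 < γ → ∀ {T : ℝ}, 0 < T →
    ∀ {N : ℕ} (i b : Fin N), (b.val = 0 ∨ b.val = N - 1) → ∀ {u : PhaseSpace N → ℝ}, ContDiff ℝ ∞ u →
    MemLp u 2 (gibbsWeight ω₂ lam β γ N T) →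
    (∀ x, (pinnedChain ω₂ lam β γ).generator N T T u x = -(∑ k : Fin N, (pinnedChain ω₂ lam β γ).bondCurrent N k x)) →
    MemLp (fun x => -(T * partialP b (partialP b (fun y : PhaseSpace N => (u y + u (y.1, -y.2)) / 2)) x) +
      x.2 b * partialP b (fun y : PhaseSpace N => (u y + u (y.1, -y.2)) / 2) x) 2 (gibbsWeight ω₂ lam β γ N T) →
    ∀ {s : ℝ}, 0 ≤ s →
    |T * ∫ x, partialP b (fun y : PhaseSpace N => (u y + u (y.1, -y.2)) / 2) x *
        partialP b (fun y : PhaseSpace N => (pinnedChain ω₂ lam β γ).bondCurrent N i (detFlow ω₂ lam β N s y)) x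
        ∂(gibbsWeight ω₂ lam β γ N T)| ≤
      Real.sqrt (∫ x, (-(T * partialP b (partialP b (fun y : PhaseSpace N => (u y + u (y.1, -y.2)) / 2)) x) +
          x.2 b * partialP b (fun y : PhaseSpace N => (u y + u (y.1, -y.2)) / 2) x) ^ 2 ∂(gibbsWeight ω₂ lam β γ N T)) *
      Real.sqrt (∫ x, (∫ p', ((pinnedChain ω₂ lam β γ).bondCurrent N i (detFlow ω₂ lam β N s (x.1, Function.update x.2 b p')) -
          (pinnedChain ω₂ lam β γ).bondCurrent N i (detFlow ω₂ lam β N s x)) ^ 2 ∂(gaussianReal 0 (Real.toNNReal T)))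
          ∂(gibbsWeight ω₂ lam β γ N T)) := by
  intro ω₂ lam β γ hω hl hβ hγ T hT N i b hb u hu hu2 hpde hN2 s hs
  exact abs_pairing_le_sqrt_mul_sqrt hω hl hβ hγ hT i b hb hu hu2 hpde hN2 hs

/-- **The foreseen glued split, PROVED: H1 (`BoundaryHermiteRegularity`) → C′ (`ResampledKickCone`) → P**,
with `a = a_K`, `C = √(max C_H 0 · max C_K 0)`. [folklore] -/
theorem tapLeakBound_of_hermite_of_kickCone :
    (∀ ω₂ lam β γ : ℝ, 0 < ω₂ → 0 < lam → 0 < β → 0 < γ → ∀ T : ℝ, 0 < T →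
      ∃ C : ℝ, ∀ (N : ℕ) (b : Fin N) (u : PhaseSpace N → ℝ), (b.val = 0 ∨ b.val = N - 1) →
        let P := pinnedChain ω₂ lam β γ
        let μT : Measure (PhaseSpace N) :=
          volume.withDensity (fun x : PhaseSpace N => ENNReal.ofReal (Real.exp (-(P.hamiltonian N x) / T)))
        let J : PhaseSpace N → ℝ := fun z => ∑ k : Fin N, P.bondCurrent N k z
        let ue : PhaseSpace N → ℝ := fun x => (u x + u (x.1, -x.2)) / 2
        let Nue : PhaseSpace N → ℝ := fun x => -(T * partialP b (partialP b ue) x) + x.2 b * partialP b ue x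
        ContDiff ℝ 1 u → MemLp u 2 μT →
        (∀ᵐ x ∂μT, Tendsto (fun τ : ℝ => ∫ t in Set.Ioc (0 : ℝ) τ,
            (∫ y, J y ∂(P.transitionKernel N T T t.toNNReal x))) atTop (𝓝 (u x))) →
          MemLp Nue 2 μT ∧
          ∫ x, (Nue x) ^ 2 ∂μT ≤
            C * (|∫ x, u x * J x ∂μT| + ∫ x, Real.exp (-(P.hamiltonian N x) / T) ∂volume)) →
    (∀ ω₂ lam β γ : ℝ, 0 < ω₂ → 0 < lam → 0 < β → 0 < γ → ∀ T : ℝ, 0 < T →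
      ∃ a C : ℝ, 0 < a ∧ ∀ (N : ℕ) (i b : Fin N) (s : ℝ), (b.val = 0 ∨ b.val = N - 1) → 0 ≤ s →
        let P := pinnedChain ω₂ lam β γ
        let P₀ := pinnedChain ω₂ lam β 0
        let μT : Measure (PhaseSpace N) :=
          volume.withDensity (fun x : PhaseSpace N => ENNReal.ofReal (Real.exp (-(P.hamiltonian N x) / T)))
        let js : PhaseSpace N → ℝ := fun x => ∫ y, P.bondCurrent N i y ∂(P₀.transitionKernel N T T s.toNNReal x)
        let d : ℕ := if b.val = 0 then i.val else N - 2 - i.val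
        s ≤ a * (d : ℝ) →
          ∫ x, (∫ p', (js (x.1, Function.update x.2 b p') - js x) ^ 2 ∂(gaussianReal 0 (Real.toNNReal T))) ∂μT
            ≤ C * (∫ x, Real.exp (-(P.hamiltonian N x) / T) ∂volume) / (1 + ((d : ℝ) - s / a)) ^ 3) →
    TapLeakBound := by
  intro hH1 hC ω₂ lam β γ hω hl hβ hγ T hT
  obtain ⟨CH₀, hH⟩ := hH1 ω₂ lam β γ hω hl hβ hγ T hT
  obtain ⟨a, CK₀, ha, hK⟩ := hC ω₂ lam β γ hω hl hβ hγ T hT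
  set CH : ℝ := max CH₀ 0 with hCHdef
  set CK : ℝ := max CK₀ 0 with hCKdef
  have hCH0 : 0 ≤ CH := le_max_right _ _
  have hCK0 : 0 ≤ CK := le_max_right _ _
  refine ⟨a, Real.sqrt (CH * CK), ha, fun N i b u s hb hs => ?_⟩
  dsimp only
  intro hu1 hu2 hlim hsd
  set P := pinnedChain ω₂ lam β γ with hP
  set μ := gibbsWeight ω₂ lam β γ N T with hμ
  set Z : ℝ := ∫ x, Real.exp (-(P.hamiltonian N x) / T) ∂volume with hZ
  set d : ℕ := (if b.val = 0 then i.val else N - 2 - i.val) with hd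
  set ue : PhaseSpace N → ℝ := fun y => (u y + u (y.1, -y.2)) / 2 with hue
  set Nue : PhaseSpace N → ℝ := fun x => -(T * partialP b (partialP b ue) x) + x.2 b * partialP b ue x with hNue
  have hjs : ∀ x : PhaseSpace N, ∫ y, P.bondCurrent N i y
      ∂((pinnedChain ω₂ lam β 0).transitionKernel N T T s.toNNReal x) =
      P.bondCurrent N i (detFlow ω₂ lam β N s x) := fun x => by
    rw [integral_transitionKernel_zero_friction hω hl.le hβ.le, Real.coe_toNNReal s hs]
  obtain ⟨hu, hpde⟩ := stub_correctorSmooth hω hl hβ hγ hT hu1.continuous hlim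
  obtain ⟨hN2, hNle⟩ := hH N b u hb hu1 hu2 hlim
  have hV := hK N i b s hb hs hsd
  dsimp only at hV
  simp only [hjs] at hV
  have hpair := abs_pairing_le_sqrt_mul_sqrt hω hl hβ hγ hT i b hb hu hu2 hpde hN2 hs
  simp only [hjs]
  refine hpair.trans ?_
  set M : ℝ := |∫ x, u x * ∑ k : Fin N, P.bondCurrent N k x ∂μ| + Z with hM
  set D : ℝ := 1 + ((d : ℝ) - s / a) with hD
  have hZ0 : 0 ≤ Z := integral_nonneg fun x => (Real.exp_pos _).le
  have hM0 : 0 ≤ M := add_nonneg (abs_nonneg _) hZ0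
  have hD1 : 1 ≤ D := by
    have : s / a ≤ (d : ℝ) := by rw [div_le_iff₀ ha]; linarith [mul_comm a (d : ℝ)]
    rw [hD]; linarith
  have hD0 : 0 < D := by linarith
  have hNle' : ∫ x, (Nue x) ^ 2 ∂μ ≤ CH * M :=
    hNle.trans (mul_le_mul_of_nonneg_right (le_max_left _ _) hM0)
  have h1 : Real.sqrt (∫ x, (Nue x) ^ 2 ∂μ) ≤ Real.sqrt (CH * M) := Real.sqrt_le_sqrt hNle'
  have h2 : Real.sqrt (∫ x, (∫ p', (P.bondCurrent N i (detFlow ω₂ lam β N s (x.1, Function.update x.2 b p')) -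
      P.bondCurrent N i (detFlow ω₂ lam β N s x)) ^ 2 ∂(gaussianReal 0 (Real.toNNReal T))) ∂μ) ≤
      Real.sqrt (CK * Z / D ^ 3) := by
    refine Real.sqrt_le_sqrt (hV.trans ?_)
    exact div_le_div_of_nonneg_right (mul_le_mul_of_nonneg_right (le_max_left _ _) hZ0) (pow_nonneg hD0.le 3)
  have hD32 : Real.sqrt (D ^ 3) = D ^ (3 / 2 : ℝ) := by
    rw [Real.sqrt_eq_rpow, ← Real.rpow_natCast, ← Real.rpow_mul hD0.le]
    norm_num
  calc Real.sqrt (∫ x, (Nue x) ^ 2 ∂μ) *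
        Real.sqrt (∫ x, (∫ p', (P.bondCurrent N i (detFlow ω₂ lam β N s (x.1, Function.update x.2 b p')) -
          P.bondCurrent N i (detFlow ω₂ lam β N s x)) ^ 2 ∂(gaussianReal 0 (Real.toNNReal T))) ∂μ)
      ≤ Real.sqrt (CH * M) * Real.sqrt (CK * Z / D ^ 3) :=
        mul_le_mul h1 h2 (Real.sqrt_nonneg _) (Real.sqrt_nonneg _)
    _ = Real.sqrt (CH * CK) * Real.sqrt (M * Z) / Real.sqrt (D ^ 3) := by
        rw [Real.sqrt_div' _ (pow_nonneg hD0.le 3), ← mul_div_assoc]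
        congr 1
        rw [← Real.sqrt_mul (mul_nonneg hCH0 hM0), ← Real.sqrt_mul (mul_nonneg hCH0 hCK0)]
        congr 1; ring
    _ = Real.sqrt (CH * CK) * Real.sqrt (M * Z) / D ^ (3 / 2 : ℝ) := by rw [hD32]

end Summit.AtomisticToContinuum.FouriersLaw.Theorems.OddSectorIrreversibility.TapLeak

end
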